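import Literature.MathematicalPhysics.QuantumFieldTheory.Balaban1983to89.T4ForestGaugeSameRootBound
import Literature.MathematicalPhysics.QuantumFieldTheory.Balaban1983to89.LatticeWordCountBox
import Literature.MathematicalPhysics.QuantumFieldTheory.Balaban1983to89.B15Prop1MinimiserTowerAxialGauge

/-!
# `Balaban1983to89.B15Prop1InteriorLetterSameRoot` — [Balaban1985Variational] = «[15]», (16)–(18) p. 280 ∕ [Balaban1985RegularSpaces] = «[6]», (1.19) p. 79:
# THE SAME-ROOT HALF OF THE INTERIOR LETTER `hL` — in the tower-axial gauge `σ(x) = 𝒰_{U₀}(path x)` of a rooted forest given in WORD currency, every bond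
# inside `Ω₁(Z)` whose two endpoints hang from ONE root is within `((2ℓ + 1)²∕4)·εP` of `1`, from ONE plaquette letter on the boxes around the roots

statement-level skeleton of published theorems with citation tags; proofs where landed; nothing here is a claim about the Yang–Mills mass gap

WHY (cell `pub-ymgap`, HUMAN RULINGS D-0062 ∕ D-0149 ∕ D-0154, width seat `pub-ymgap-dag-n12-w6` g2; node N12 = [B15]; lane word dag-n12-c g19 «w6 take hL-same», cell bus
2026-08-28).  After the lane ruling (R-a) the localised gauge letter (σ)_N of `B15Prop1GaugeLetterGammaZeroPin` §4 displays ONE analytic letter: the interior estimate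
`hL : ∀ b, b.src ∈ Ω₁(Z) → b.tgt ∈ Ω₁(Z) → ‖↑((U₀^{σ_path}) b) − 1‖ ≤ Θ` ([15] (16)–(18) in the axial gauge `Ax_k(𝔅_k, U₀)` of [6] (1.19)).  In the rooted forest of `𝐁_k(Z)`
(dag-n12-w3's tower forest in word currency: `path x = walk (root x) (word x)`, `walkEnd (root x) (word x) = x`, `|path x| ≤ ℓ`) a bond `b = ⟨s, s + e_μ⟩` inside `Ω₁(Z)` is of ONE of
two kinds: SAME ROOT (`root s = root (s + e_μ)`) — then `(U₀^σ)(b) = 𝒰_r(w₋ · (+e_μ) · w₊ᵒᵖ)` is the holonomy of a CLOSED word of length `≤ 2ℓ + 1` based at the root, within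
`((2ℓ + 1)²∕4)·εP` of `1` as soon as the plaquettes in the box of radius `2ℓ + 1` (+2) around the root are `εP`-small (`T4ForestGaugeSameRootBound` + `LatticeWordCountBox`, BY NAME) —
or TWO ROOTS (a corridor bond; `T4ForestGaugeCorridorBound`'s MASTER shape, the next file of this lineage).  THIS FILE discharges the same-root kind and states the split
`hL(max Θs Θc) ⟸ hL_same(Θs) ∧ hL_corridor(Θc)`, so that after it the interior letter displays ONLY its two-root half.

CONTENTS (theorems only; no `def`, no `instance`, no `sorry`).
* §1 ★★ `dist1_gaugeAct_holAtGauge_le_of_sameRoot_of_boxPlaqs` — ONE bond whose ends hang from one root `castSite z` by words of length `≤ ℓ` (`2ℓ + 1 <` sites per direction):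
  `PlaqSmallOn S δ U` with `boxPlaqs (z − (2ℓ+1)) (z + (2ℓ+1) + 2) ⊆ S` ⟹ `dist1 ((U^σ) b) ≤ ((2ℓ+1)²∕4)·δ` (any level, any `GaugeGroup`).
* §2 ★★ `dist1_gaugeAct_holAtGauge_le_of_rootEq` — the forest-in-word-currency edition on a site set `Ω`: uniform length bound on `Ω`, one box premise per site of `Ω`.
* §3 ★★★ `interiorLetter_sameRoot_atRecord` — the `SU(2)` matrix-norm reading at `Ω₁(Z) = maxDomT ν.M₁ Z 1` for the gauged minimiser of the endpoint (`hL_same`);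
  ★ `interiorLetter_of_sameRoot_of_corridor` — the split junction; ★ `interiorLetter_of_sameRoot_of_corridor_linear` — both halves linear in the guard ⟹ `hL` with `Θ ≤ (Cs + Cc)·eR`
  (the `hΘle` input of `B15Prop1GaugeLetterGammaZeroPin` §5).
* §4 ★ `plaqBonds_mem_of_plaqClosure` — the socket's plaquette-closure letter (hN2) on the neighbourhood `N` gives the producer's C1-premise `hN1` (set bookkeeping).

HONEST FRAMING: [folklore] lattice bookkeeping + two landed bricks by name; the CORRIDOR (two-root) bonds, the forest, the minimiser ([15] Thm 1) and the plaquette letter ((1.7) at the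
minimiser, [15] Thm 1 (8)) stay DISPLAYED; nothing of Bałaban's is asserted; count-neutral; N12 NOT discharged; finite 𝕋⁴ at fixed ε; nothing continuum ∕ OS ∕ mass-gap ∕ Clay.
-/

noncomputable section

open scoped Matrix.Norms.L2Operator

namespace Literature.MathematicalPhysics.QuantumFieldTheory.Balaban1983to89.B15Prop1InteriorLetterSameRoot

open T4Continuum GaugeField B15DeterminingSets
open B14.Eq12InteriorLocality (plaqBonds mem_plaqBonds)
open T4CubeChartGnomonic (SU2)
open T4AxialGaugeSmallField (castSite boxPlaqs)
open B14.Eq213DetSet (maxDomT)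
open T4ForestGaugeSameRootBound (dist1_gaugeAct_holAtGauge_le_of_sameRoot_of_length_lt)
open LatticeWordCountBox (plaq_countBox_lt_of_plaqSmallOn_boxPlaqs_length)

variable {P : Params} {j : ℕ}

/-! ## §1  One bond hanging from one root: the box edition of the same-root bound -/

section OneBond

variable {G : Type*} [GaugeGroup G]

/-- The loop word `w₋ · (+e_μ) · w₊ᵒᵖ` has length `|w₋| + 1 + |w₊|`. [folklore] -/
private theorem length_loopWord (μ : Fin P.d) (wm wp : List (Letter P.d)) :
    (wm ++ (μ, true) :: wordRev wp).length = wm.length + 1 + wp.length := by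
  simp only [List.length_append, List.length_cons, wordRev, List.length_reverse, List.length_map]
  omega

/-- A coordinate box grows with its radius: `boxPlaqs (z − a) (z + a + 2) ⊆ boxPlaqs (z − b) (z + b + 2)` for `a ≤ b`. [folklore] -/
private theorem boxPlaqs_radius_mono (z : Fin P.d → ℤ) {a b : ℤ} (hab : a ≤ b) :
    (boxPlaqs (fun ν => z ν - a) (fun ν => z ν + a + 2) : Set (Plaq P j)) ⊆ boxPlaqs (fun ν => z ν - b) (fun ν => z ν + b + 2) := by
  rintro p ⟨z', hlo, hhi, hsrc⟩
  refine ⟨z', fun ν => le_trans ?_ (hlo ν), fun ν => (hhi ν).trans ?_, hsrc⟩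
  · show z ν - b ≤ z ν - a
    linarith
  · show z ν + a + 2 ≤ z ν + b + 2
    linarith

/-- ★★ **THE SAME-ROOT BOND BOUND, BOX EDITION.**  In the forest gauge `σ(x) = 𝒰_U(path x)`: if `path s = walk r w₋` and `path (s + e_μ) = walk r w₊` end at `s` and `s + e_μ`, with
`|w₋|, |w₊| ≤ ℓ` and `2ℓ + 1 <` the number of sites per direction (no wrapping), `r = castSite z`, and every plaquette with corners in the box `[z − (2ℓ+1), z + (2ℓ+1) + 2]` is
`δ`-small (`PlaqSmallOn S δ U`, box `⊆ S`, `0 ≤ δ`), then `dist1 ((U^σ)⟨s, μ⟩) ≤ ((2ℓ + 1)²∕4)·δ` — the loop `w₋ · (+e_μ) · w₊ᵒᵖ` has length `≤ 2ℓ + 1` and its count box lies in that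
coordinate box (`LatticeWordCountBox.plaq_countBox_lt_of_plaqSmallOn_boxPlaqs_length`), so `T4ForestGaugeSameRootBound.dist1_gaugeAct_holAtGauge_le_of_sameRoot_of_length_lt` applies.
[cite: Balaban1985Variational, (16)–(18) p.280; Balaban1985RegularSpaces, (1.19) p.79; Balaban1985Averaging, (19)–(20) p.21] -/
theorem dist1_gaugeAct_holAtGauge_le_of_sameRoot_of_boxPlaqs (U : GaugeField P j G) (path : Site P j → List (LStep P j)) (r s : Site P j) (μ : Fin P.d)
    (wm wp : List (Letter P.d)) (hps : path s = walk r wm) (hpt : path (s.shift μ) = walk r wp)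
    (hs : walkEnd r wm = s) (ht : walkEnd r wp = s.shift μ) {ℓ : ℕ} (hwm : wm.length ≤ ℓ) (hwp : wp.length ≤ ℓ) (hN : 2 * ℓ + 1 < P.sitesPerDir j)
    (z : Fin P.d → ℤ) (hz : (castSite z : Site P j) = r) {S : Set (Plaq P j)} {δ : ℝ} (hδ : 0 ≤ δ) (hU : PlaqSmallOn S δ U)
    (hS : (boxPlaqs (fun ν => z ν - ((2 * ℓ + 1 : ℕ) : ℤ)) (fun ν => z ν + ((2 * ℓ + 1 : ℕ) : ℤ) + 2) : Set (Plaq P j)) ⊆ S) :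
    dist1 (gaugeAct (fun x => holAt U (path x)) U ⟨s, μ⟩) ≤ ((((2 * ℓ + 1 : ℕ) : ℝ)) ^ 2 / 4) * δ := by
  have hlen : wm.length + 1 + wp.length < P.sitesPerDir j := by omega
  have hwlen : ((wm ++ (μ, true) :: wordRev wp).length : ℤ) ≤ ((2 * ℓ + 1 : ℕ) : ℤ) := by
    rw [length_loopWord]
    exact_mod_cast (show wm.length + 1 + wp.length ≤ 2 * ℓ + 1 by omega)
  have hS' : (boxPlaqs (fun ν => z ν - ((wm ++ (μ, true) :: wordRev wp).length : ℤ))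
      (fun ν => z ν + ((wm ++ (μ, true) :: wordRev wp).length : ℤ) + 2) : Set (Plaq P j)) ⊆ S :=
    (boxPlaqs_radius_mono z hwlen).trans hS
  have hloc := plaq_countBox_lt_of_plaqSmallOn_boxPlaqs_length U r z hz (wm ++ (μ, true) :: wordRev wp) hU hS'
  have h := dist1_gaugeAct_holAtGauge_le_of_sameRoot_of_length_lt U path r s μ wm wp hps hpt hs ht hlen hδ hloc
  refine h.trans (mul_le_mul_of_nonneg_right ?_ hδ)
  have hcast : ((wm.length + 1 + wp.length : ℕ) : ℝ) ≤ ((2 * ℓ + 1 : ℕ) : ℝ) := by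
    exact_mod_cast (show wm.length + 1 + wp.length ≤ 2 * ℓ + 1 by omega)
  have h0 : (0 : ℝ) ≤ ((wm.length + 1 + wp.length : ℕ) : ℝ) := by positivity
  exact div_le_div_of_nonneg_right (pow_le_pow_left₀ h0 hcast 2) (by norm_num)

end OneBond

/-! ## §2  The forest in word currency: every same-root bond inside a site set -/

section Forest

variable {G : Type*} [GaugeGroup G]

/-- The word of a path (its letters) has the length of the path. [folklore] -/
private theorem length_word (p : List (LStep P j)) : (p.map fun s => (s.bond.dir, s.fwd)).length = p.length :=
  List.length_map _

/-- ★★ **EVERY SAME-ROOT BOND INSIDE `Ω` IS NEAR `1` IN THE FOREST GAUGE** (the forest given in WORD currency — dag-n12-w3's `…N12TowerForestWords.exists_towerForest_words(_Bj)` clauses, by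
shape): if every path is the walk of its letter word from its root and ends at its site, every site of `Ω` has a path of length `≤ ℓ` (`2ℓ + 1 <` sites per direction), and around the root
of every site of `Ω` the plaquettes in the box of radius `2ℓ + 1` (+2) are `δ`-small (`PlaqSmallOn S δ U` with those boxes `⊆ S`; `0 ≤ δ`), then every bond `b` with both ends in `Ω`
and `root b₋ = root b₊` satisfies `dist1 ((U^σ) b) ≤ ((2ℓ + 1)²∕4)·δ`. [cite: Balaban1985Variational, (16)–(18) p.280; Balaban1985RegularSpaces, (1.19) p.79; Balaban1985Averaging, (19)–(20) p.21] -/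
theorem dist1_gaugeAct_holAtGauge_le_of_rootEq (U : GaugeField P j G) (path : Site P j → List (LStep P j)) (root : Site P j → Site P j)
    (hwalk : ∀ x, path x = walk (root x) ((path x).map fun s => (s.bond.dir, s.fwd)) ∧
      walkEnd (root x) ((path x).map fun s => (s.bond.dir, s.fwd)) = x)
    (Ω : Set (Site P j)) {ℓ : ℕ} (hlen : ∀ x ∈ Ω, (path x).length ≤ ℓ) (hN : 2 * ℓ + 1 < P.sitesPerDir j)
    {S : Set (Plaq P j)} {δ : ℝ} (hδ : 0 ≤ δ) (hU : PlaqSmallOn S δ U)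
    (hS : ∀ x ∈ Ω, ∃ z : Fin P.d → ℤ, (castSite z : Site P j) = root x ∧
      (boxPlaqs (fun ν => z ν - ((2 * ℓ + 1 : ℕ) : ℤ)) (fun ν => z ν + ((2 * ℓ + 1 : ℕ) : ℤ) + 2) : Set (Plaq P j)) ⊆ S)
    {b : PBond P j} (hbs : b.src ∈ Ω) (hbt : b.tgt ∈ Ω) (hroot : root b.src = root b.tgt) :
    dist1 (gaugeAct (fun x => holAt U (path x)) U b) ≤ ((((2 * ℓ + 1 : ℕ) : ℝ)) ^ 2 / 4) * δ := by
  obtain ⟨s, μ⟩ := b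
  obtain ⟨z, hz, hSz⟩ := hS s hbs
  have htgt : (PBond.tgt ⟨s, μ⟩ : Site P j) = s.shift μ := rfl
  rw [htgt] at hbt hroot
  obtain ⟨hps, hs⟩ := hwalk s
  obtain ⟨hpt, ht⟩ := hwalk (s.shift μ)
  rw [← hroot] at hpt ht
  refine dist1_gaugeAct_holAtGauge_le_of_sameRoot_of_boxPlaqs U path (root s) s μ _ _ hps hpt hs ht ?_ ?_ hN z hz hδ hU hSz
  · rw [length_word]; exact hlen s hbs
  · rw [length_word]; exact hlen _ hbt

end Forest

/-! ## §3  At the endpoint's objects: `hL_same`, and the split `hL ⟸ hL_same ∧ hL_corridor` -/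

section Record

/-- ★★★ **THE SAME-ROOT HALF OF THE INTERIOR LETTER AT THE RECORD (`hL_same`).**  For the gauged (2.12) minimiser `U₀^σ`, `σ(x) = 𝒰_{U₀}(path x)`, of the endpoint at one instance
(`Ω₁(Z) = maxDomT ν.M₁ Z 1`; the tower forest of `𝐁_k(Z)` in word currency with the uniform length bound `ℓ` on `Ω₁(Z)`; `2ℓ + 1 <` fine sites per direction) and ONE displayed
plaquette letter `hP : PlaqSmallOn S εP U₀` on a fine plaquette set `S` containing the boxes of radius `2ℓ + 1` (+2) around the roots of the sites of `Ω₁(Z)` — print's (1.7) for the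
minimiser on the support `Ω₀ ⊃ Ω₁` ([15] (2) ∕ Thm 1 (8)) — every bond with both ends in `Ω₁(Z)` whose ends have the same root satisfies
`‖↑((U₀^σ) b) − 1‖ ≤ ((2ℓ + 1)²∕4)·εP` (the `SU(2)` reading `dist1 = ‖· − 1‖`, `B15Prop1DatumGaugeNormalisation.dist1_eq_norm_sub_one_su2`).
[cite: Balaban1985Variational, (2) p.278, Thm 1 (8) p.279, (16)–(18) p.280; Balaban1985RegularSpaces, (1.7) p.77, (1.19) p.79; Balaban1985Averaging, (19)–(20) p.21] -/
theorem interiorLetter_sameRoot_atRecord {F : T4Family} (ν : Node00.Stage7Numerics) (Kt : ℕ) (Z : Set (Site (F.P Kt) 0))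
    (path : Site (F.P Kt) 0 → List (LStep (F.P Kt) 0)) (root : Site (F.P Kt) 0 → Site (F.P Kt) 0)
    (hwalk : ∀ x, path x = walk (root x) ((path x).map fun s => (s.bond.dir, s.fwd)) ∧
      walkEnd (root x) ((path x).map fun s => (s.bond.dir, s.fwd)) = x)
    {ℓ : ℕ} (hlen : ∀ x ∈ maxDomT ν.M₁ Z 1, (path x).length ≤ ℓ) (hN : 2 * ℓ + 1 < (F.P Kt).sitesPerDir 0)
    (U₀ : GaugeField (F.P Kt) 0 SU2) {S : Set (Plaq (F.P Kt) 0)} {εP : ℝ} (hεP : 0 ≤ εP) (hP : PlaqSmallOn S εP U₀)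
    (hS : ∀ x ∈ maxDomT ν.M₁ Z 1, ∃ z : Fin (F.P Kt).d → ℤ, (castSite z : Site (F.P Kt) 0) = root x ∧
      (boxPlaqs (fun κ => z κ - ((2 * ℓ + 1 : ℕ) : ℤ)) (fun κ => z κ + ((2 * ℓ + 1 : ℕ) : ℤ) + 2) : Set (Plaq (F.P Kt) 0)) ⊆ S) :
    ∀ b : PBond (F.P Kt) 0, b.src ∈ maxDomT ν.M₁ Z 1 → b.tgt ∈ maxDomT ν.M₁ Z 1 → root b.src = root b.tgt →
      ‖((gaugeAct (fun x => holAt U₀ (path x)) U₀ b : SU2) : Matrix (Fin 2) (Fin 2) ℂ) - 1‖ ≤ ((((2 * ℓ + 1 : ℕ) : ℝ)) ^ 2 / 4) * εP :=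
  fun _ hbs hbt hroot => dist1_gaugeAct_holAtGauge_le_of_rootEq U₀ path root hwalk (maxDomT ν.M₁ Z 1) hlen hN hεP hP hS hbs hbt hroot

/-- ★ **THE SPLIT OF THE INTERIOR LETTER: `hL(max Θs Θc) ⟸ hL_same(Θs) ∧ hL_corridor(Θc)`.**  Every bond inside `Ω₁(Z)` is a same-root bond or a two-root (corridor) bond; the
same-root half is `interiorLetter_sameRoot_atRecord`, the corridor half `hL_corridor : ∀ b, b.src ∈ Ω₁ → b.tgt ∈ Ω₁ → root b.src ≠ root b.tgt → ‖…‖ ≤ Θc` stays DISPLAYED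
(`T4ForestGaugeCorridorBound`'s MASTER shape); together they give the interior letter `hL` of `B15Prop1GaugeLetterGammaZeroPin` §4 with `Θ := max Θs Θc`.
[cite: Balaban1985Variational, (16)–(18) p.280; Balaban1985RegularSpaces, (1.19) p.79] -/
theorem interiorLetter_of_sameRoot_of_corridor {F : T4Family} (ν : Node00.Stage7Numerics) (Kt : ℕ) (Z : Set (Site (F.P Kt) 0))
    (path : Site (F.P Kt) 0 → List (LStep (F.P Kt) 0)) (root : Site (F.P Kt) 0 → Site (F.P Kt) 0)
    (U₀ : GaugeField (F.P Kt) 0 SU2) {Θs Θc : ℝ}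
    (hsame : ∀ b : PBond (F.P Kt) 0, b.src ∈ maxDomT ν.M₁ Z 1 → b.tgt ∈ maxDomT ν.M₁ Z 1 → root b.src = root b.tgt →
      ‖((gaugeAct (fun x => holAt U₀ (path x)) U₀ b : SU2) : Matrix (Fin 2) (Fin 2) ℂ) - 1‖ ≤ Θs)
    (hcorr : ∀ b : PBond (F.P Kt) 0, b.src ∈ maxDomT ν.M₁ Z 1 → b.tgt ∈ maxDomT ν.M₁ Z 1 → root b.src ≠ root b.tgt →
      ‖((gaugeAct (fun x => holAt U₀ (path x)) U₀ b : SU2) : Matrix (Fin 2) (Fin 2) ℂ) - 1‖ ≤ Θc) :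
    ∀ b : PBond (F.P Kt) 0, b.src ∈ maxDomT ν.M₁ Z 1 → b.tgt ∈ maxDomT ν.M₁ Z 1 →
      ‖((gaugeAct (fun x => holAt U₀ (path x)) U₀ b : SU2) : Matrix (Fin 2) (Fin 2) ℂ) - 1‖ ≤ max Θs Θc := by
  intro b hbs hbt
  by_cases hroot : root b.src = root b.tgt
  · exact (hsame b hbs hbt hroot).trans (le_max_left _ _)
  · exact (hcorr b hbs hbt hroot).trans (le_max_right _ _)

/-- ★ **BOTH HALVES LINEAR IN THE GUARD ⟹ `hL` WITH `Θ ≤ (Cs + Cc)·eR`** (the `hΘle` input of `B15Prop1GaugeLetterGammaZeroPin.exists_gaugeLetterLoc_linear_atRecord`): from `Θs ≤ Cs·eR`,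
`Θc ≤ Cc·eR`, `0 ≤ Cs`, `0 ≤ Cc`, `0 < eR`. [cite: Balaban1985Variational, (16)–(18) p.280; Balaban1989LargeFieldI, Prop. 1 p.194 («for ε > 0 sufficiently small»)] -/
theorem interiorLetter_of_sameRoot_of_corridor_linear {F : T4Family} (ν : Node00.Stage7Numerics) (Kt : ℕ) (Z : Set (Site (F.P Kt) 0))
    (path : Site (F.P Kt) 0 → List (LStep (F.P Kt) 0)) (root : Site (F.P Kt) 0 → Site (F.P Kt) 0)
    (U₀ : GaugeField (F.P Kt) 0 SU2) {Θs Θc Cs Cc eR : ℝ} (hCs : 0 ≤ Cs) (hCc : 0 ≤ Cc) (heR : 0 < eR)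
    (hΘs : Θs ≤ Cs * eR) (hΘc : Θc ≤ Cc * eR)
    (hsame : ∀ b : PBond (F.P Kt) 0, b.src ∈ maxDomT ν.M₁ Z 1 → b.tgt ∈ maxDomT ν.M₁ Z 1 → root b.src = root b.tgt →
      ‖((gaugeAct (fun x => holAt U₀ (path x)) U₀ b : SU2) : Matrix (Fin 2) (Fin 2) ℂ) - 1‖ ≤ Θs)
    (hcorr : ∀ b : PBond (F.P Kt) 0, b.src ∈ maxDomT ν.M₁ Z 1 → b.tgt ∈ maxDomT ν.M₁ Z 1 → root b.src ≠ root b.tgt →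
      ‖((gaugeAct (fun x => holAt U₀ (path x)) U₀ b : SU2) : Matrix (Fin 2) (Fin 2) ℂ) - 1‖ ≤ Θc) :
    ∀ b : PBond (F.P Kt) 0, b.src ∈ maxDomT ν.M₁ Z 1 → b.tgt ∈ maxDomT ν.M₁ Z 1 →
      ‖((gaugeAct (fun x => holAt U₀ (path x)) U₀ b : SU2) : Matrix (Fin 2) (Fin 2) ℂ) - 1‖ ≤ (Cs + Cc) * eR := by
  have hmax : max Θs Θc ≤ (Cs + Cc) * eR := by
    have h1 : 0 ≤ Cs * eR := mul_nonneg hCs heR.le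
    have h2 : 0 ≤ Cc * eR := mul_nonneg hCc heR.le
    refine max_le ?_ ?_ <;> nlinarith
  intro b hbs hbt
  exact (interiorLetter_of_sameRoot_of_corridor ν Kt Z path root U₀ hsame hcorr b hbs hbt).trans hmax

end Record

/-! ## §4  The socket's geometry letter (hN2) gives the producer's plaquette premise (hN1 of `B15Prop1GaugeLetterGammaZeroPin` §4) -/

section Socket

/-- ★ **(hN2) ⟹ the producer's C1-premise.**  The lane's socket of record (cell bus 2026-08-28, «SOCKET OF RECORD v2») carries ONE plaquette-closure letter on the neighbourhood binder `N`:
«`N ⊇` the plaquette-closure of `bondsOf Ω₁ ∪ I`» (`I` = `inputsPos 𝐁_k(Z)` there), i.e. every plaquette having a bond in `bondsOf Ω₁ ∪ I` has all four bonds (`plaqBonds p`) in `N`.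
It yields the premise `hN1` of `B15Prop1GaugeLetterGammaZeroPin.exists_gaugeLetterLoc_atRecord` (the four bonds of every `Ω₁`-touching plaquette lie in `N`): the touching bond is sourced
in `Ω₁`, hence in `bondsOf Ω₁`. (set bookkeeping). [cite: Balaban1988Convergent, (2.2) p.255 (bookkeeping); Balaban1985Averaging, (9) p.19] -/
theorem plaqBonds_mem_of_plaqClosure (Ω₁ : Set (Site P j)) (I N : Set (PBond P j))
    (hN2 : ∀ p : Plaq P j, (∃ b ∈ plaqBonds p, b ∈ bondsOf Ω₁ ∨ b ∈ I) → plaqBonds p ⊆ N) :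
    ∀ p : Plaq P j, ((⟨p.src, p.μ⟩ : PBond P j) ∈ {b : PBond P j | b.src ∈ Ω₁} ∨
        (⟨p.src.shift p.μ, p.ν⟩ : PBond P j) ∈ {b : PBond P j | b.src ∈ Ω₁} ∨
        (⟨p.src.shift p.ν, p.μ⟩ : PBond P j) ∈ {b : PBond P j | b.src ∈ Ω₁} ∨
        (⟨p.src, p.ν⟩ : PBond P j) ∈ {b : PBond P j | b.src ∈ Ω₁}) →
      (⟨p.src, p.μ⟩ : PBond P j) ∈ N ∧ (⟨p.src.shift p.μ, p.ν⟩ : PBond P j) ∈ N ∧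
        (⟨p.src.shift p.ν, p.μ⟩ : PBond P j) ∈ N ∧ (⟨p.src, p.ν⟩ : PBond P j) ∈ N := by
  intro p hp
  have h1 : (⟨p.src, p.μ⟩ : PBond P j) ∈ plaqBonds p := mem_plaqBonds.2 (Or.inl rfl)
  have h2 : (⟨p.src.shift p.μ, p.ν⟩ : PBond P j) ∈ plaqBonds p :=
    mem_plaqBonds.2 (Or.inr (Or.inl rfl))
  have h3 : (⟨p.src.shift p.ν, p.μ⟩ : PBond P j) ∈ plaqBonds p :=
    mem_plaqBonds.2 (Or.inr (Or.inr (Or.inl rfl)))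
  have h4 : (⟨p.src, p.ν⟩ : PBond P j) ∈ plaqBonds p :=
    mem_plaqBonds.2 (Or.inr (Or.inr (Or.inr rfl)))
  have hsub : plaqBonds p ⊆ N := by
    refine hN2 p ?_
    rcases hp with h | h | h | h
    · exact ⟨_, h1, Or.inl (Or.inl h)⟩
    · exact ⟨_, h2, Or.inl (Or.inl h)⟩
    · exact ⟨_, h3, Or.inl (Or.inl h)⟩
    · exact ⟨_, h4, Or.inl (Or.inl h)⟩
  exact ⟨hsub h1, hsub h2, hsub h3, hsub h4⟩

end Socket

end Literature.MathematicalPhysics.QuantumFieldTheory.Balaban1983to89.B15Prop1InteriorLetterSameRoot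

end
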